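import Literature.Combinatorics.Additive.GlibichukKonyaginDichotomy
import Mathlib.Analysis.SpecialFunctions.Pow.Real

/-!
# An explicit sum–product estimate in `𝔽_p` (Bourgain–Katz–Tao; Garaev's scheme), weak form

Topic `Literature/Combinatorics/Additive`. Everything here is PROVED; no definitions, no named facts.

**Theorem** (`card_le_of_small_sumset_and_productset`). Let `p` be prime and `A ⊆ 𝔽_p` with
`0 ∉ A`, `|A|² < p`. If `|A + A| ≤ K|A|` and `|A·A| ≤ K|A|` (`K ≥ 1`), then

  `|A| ≤ 8 · 12⁶ · K³²`.

Equivalently `max(|A+A|, |AA|) ≫ |A|^{1 + 1/32}` for `|A| < p^{1/2}` — the sum–product phenomenon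
in prime fields of Bourgain–Katz–Tao [BourgainKatzTao2004] in the explicit elementary form of
Garaev [Garaev2007, Theorem 1] (who gets the exponent `15/14`; Katz–Shen [KatzShen2008] `14/13`).
We follow Garaev's scheme with the crude bookkeeping that suffices for a fixed power of `K`:

1. `E×(A) ≥ |A|³/K` (Cauchy–Schwarz, `Finset.le_card_mul_mul_mulEnergy`) and
   `E×(A) = Σ_{a,b} r(a,b)`, `r(a,b) = #{(x,y) ∈ A² : ax = by} = |aA ∩ bA|`, give `b₀ ∈ A` and
   `A₁ = {a ∈ A : r(a,b₀) ≥ θ}`, `θ ≥ |A|/(2K)`, with `|A₁| ≥ θ` (`exists_popular_row`);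
2. Ruzsa's triangle inequality through `X = aA ∩ b₀A` and Plünnecke–Ruzsa (`|A − A| ≤ K²|A|`)
   give `|aA ± b₀A| ≤ 2K⁵|A|` for `a ∈ A₁` (`card_smul_add_smul_le`, `card_smul_sub_smul_le`);
3. the Glibichuk–Konyagin dichotomy (`glibichuk_konyagin_six_dilates`) on `A₁` gives
   `a₁, …, a₆ ∈ A₁` with `|A₁|² ≤ 2|a₁A − a₂A + ⋯ − a₆A|`;
4. that six-fold sum lies in `6Y`, `Y = ⋃ (±aᵢ)A`, and Plünnecke–Ruzsa with base `b₀A`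
   (`|b₀A + Y| ≤ 12K⁵|A|`) bounds it by `(12K⁵)⁶|A|`; so `(|A|/2K)² ≤ 2(12K⁵)⁶|A|`.

Consumers: the popular-difference / spread-set energy route of the crux `DlogGraphFlat`
(`Summits/QuantumAdvantage`, sector A; its registered stub `stub_dlogSumProductOfGK` is the
implication "dichotomy ⇒ this theorem" with unspecified constants, `stub_dlogSumProduct` the
conclusion), and finite-field sum–product estimates in general.
-/

namespace Literature.Combinatorics.Additive

open Finset
open scoped Pointwise Combinatorics.Additive

section SumProduct

variable {F : Type*} [Field F] [DecidableEq F]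

/-- Dilation distributes over pointwise subtraction of finite sets. [folklore] -/
theorem smul_finset_sub_smul_finset_eq (a : F) (s t : Finset F) : a • s - a • t = a • (s - t) := by
  ext z
  constructor
  · intro hz
    rw [Finset.mem_sub] at hz
    obtain ⟨u, hu, v, hv, rfl⟩ := hz
    rw [Finset.mem_smul_finset] at hu hv
    obtain ⟨x, hx, rfl⟩ := hu
    obtain ⟨y, hy, rfl⟩ := hv
    rw [Finset.mem_smul_finset]
    exact ⟨x - y, Finset.sub_mem_sub hx hy, by simp only [smul_eq_mul]; ring⟩
  · intro hz
    rw [Finset.mem_smul_finset] at hz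
    obtain ⟨w, hw, rfl⟩ := hz
    rw [Finset.mem_sub] at hw
    obtain ⟨x, hx, y, hy, rfl⟩ := hw
    rw [Finset.mem_sub]
    exact ⟨a • x, Finset.smul_mem_smul_finset hx, a • y, Finset.smul_mem_smul_finset hy,
      by simp only [smul_eq_mul]; ring⟩

/-- `|aS − aT| = |S − T|` for `a ≠ 0`. [folklore] -/
theorem card_smul_finset_sub_smul_finset {a : F} (ha : a ≠ 0) (s t : Finset F) :
    (a • s - a • t).card = (s - t).card := by
  rw [smul_finset_sub_smul_finset_eq, Finset.card_smul_finset₀ ha]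

/-- Plünnecke–Ruzsa (Mathlib, `ℚ≥0` form) cleared of denominators: `|nY| · |B|ⁿ ≤ |B + Y|ⁿ · |B|`.
[folklore] -/
theorem card_nsmul_mul_pow_le {G : Type*} [AddCommGroup G] [DecidableEq G] {B : Finset G}
    (hB : B.Nonempty) (Y : Finset G) (n : ℕ) :
    (n • Y).card * B.card ^ n ≤ (B + Y).card ^ n * B.card := by
  have h := Finset.pluennecke_ruzsa_inequality_nsmul_add hB Y n
  have hB0 : (B.card : ℚ≥0) ≠ 0 := by exact_mod_cast hB.card_pos.ne'
  have hBn : (B.card : ℚ≥0) ^ n ≠ 0 := pow_ne_zero _ hB0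
  have key : ((n • Y).card : ℚ≥0) * (B.card : ℚ≥0) ^ n ≤
      ((B + Y).card : ℚ≥0) ^ n * (B.card : ℚ≥0) := by
    calc ((n • Y).card : ℚ≥0) * (B.card : ℚ≥0) ^ n
        ≤ ((((B + Y).card : ℚ≥0) / B.card) ^ n * B.card) * (B.card : ℚ≥0) ^ n :=
          mul_le_mul_of_nonneg_right h (by positivity)
      _ = ((B + Y).card : ℚ≥0) ^ n * (B.card : ℚ≥0) := by
          rw [div_pow, mul_assoc, mul_comm (B.card : ℚ≥0) _, ← mul_assoc, div_mul_cancel₀ _ hBn]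
  exact_mod_cast key

/-- Plünnecke–Ruzsa for the difference set: `|A − A| · |A| ≤ |A + A|²`. [folklore] -/
theorem card_sub_mul_card_le_card_add_sq {G : Type*} [AddCommGroup G] [DecidableEq G]
    {A : Finset G} (hA : A.Nonempty) : (A - A).card * A.card ≤ (A + A).card ^ 2 := by
  have h := Finset.pluennecke_ruzsa_inequality_nsmul_sub_nsmul_add hA A 1 1
  simp only [one_nsmul] at h
  have hA0 : (A.card : ℚ≥0) ≠ 0 := by exact_mod_cast hA.card_pos.ne'
  have hA2 : (A.card : ℚ≥0) ^ 2 ≠ 0 := pow_ne_zero _ hA0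
  have key : ((A - A).card : ℚ≥0) * A.card ≤ ((A + A).card : ℚ≥0) ^ 2 := by
    calc ((A - A).card : ℚ≥0) * A.card
        ≤ ((((A + A).card : ℚ≥0) / A.card) ^ (1 + 1) * A.card) * A.card :=
          mul_le_mul_of_nonneg_right h (by positivity)
      _ = ((A + A).card : ℚ≥0) ^ 2 := by
          rw [show (1 + 1 : ℕ) = 2 from rfl, div_pow, mul_assoc, ← sq, div_mul_cancel₀ _ hA2]
  exact_mod_cast key

/-- **Step 2 of Garaev's scheme** (differences). If `X ⊆ aA ∩ bA` is non-empty then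
`|aA − bA| · |X| ≤ |A − A|²` (`a, b ≠ 0`). [cite: Garaev2007, §3] -/
theorem card_smul_sub_smul_mul_le (A X : Finset F) {a b : F} (ha : a ≠ 0) (hb : b ≠ 0)
    (hXa : X ⊆ a • A) (hXb : X ⊆ b • A) :
    (a • A - b • A).card * X.card ≤ (A - A).card * (A - A).card := by
  calc (a • A - b • A).card * X.card ≤ (a • A - X).card * (b • A - X).card :=
        Finset.ruzsa_triangle_inequality_sub_sub_sub (a • A) X (b • A)
    _ ≤ (a • A - a • A).card * (b • A - b • A).card :=
        Nat.mul_le_mul (Finset.card_le_card (Finset.sub_subset_sub_left hXa))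
          (Finset.card_le_card (Finset.sub_subset_sub_left hXb))
    _ = (A - A).card * (A - A).card := by
        rw [card_smul_finset_sub_smul_finset ha, card_smul_finset_sub_smul_finset hb]

/-- **Step 2 of Garaev's scheme** (sums). If `X ⊆ aA ∩ bA` is non-empty then
`|aA + bA| · |X| ≤ |A − A|²` (`a, b ≠ 0`). [cite: Garaev2007, §3] -/
theorem card_smul_add_smul_mul_le (A X : Finset F) {a b : F} (ha : a ≠ 0) (hb : b ≠ 0)
    (hXa : X ⊆ a • A) (hXb : X ⊆ b • A) :
    (a • A + b • A).card * X.card ≤ (A - A).card * (A - A).card := by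
  calc (a • A + b • A).card * X.card ≤ (a • A - X).card * (X - b • A).card :=
        Finset.ruzsa_triangle_inequality_add_sub_sub (a • A) X (b • A)
    _ ≤ (a • A - a • A).card * (b • A - b • A).card :=
        Nat.mul_le_mul (Finset.card_le_card (Finset.sub_subset_sub_left hXa))
          (Finset.card_le_card (Finset.sub_subset_sub_right hXb))
    _ = (A - A).card * (A - A).card := by
        rw [card_smul_finset_sub_smul_finset ha, card_smul_finset_sub_smul_finset hb]

/-- The representation count `r(a,b) = #{(x,y) ∈ A² : a x = b y}` is at most `|aA ∩ bA|`
(indeed equal) for `a, b ≠ 0`. [cite: Garaev2007, §3] -/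
theorem card_filter_mul_eq_mul_le_card_inter (A : Finset F) {a b : F} (ha : a ≠ 0) (hb : b ≠ 0) :
    ((A ×ˢ A).filter fun xy : F × F => a * xy.1 = b * xy.2).card ≤ (a • A ∩ b • A).card := by
  refine Finset.card_le_card_of_injOn (fun xy => a * xy.1) ?_ ?_
  · intro xy hxy
    rw [Finset.mem_coe, Finset.mem_filter, Finset.mem_product] at hxy
    rw [Finset.mem_coe, Finset.mem_inter]
    refine ⟨Finset.smul_mem_smul_finset (a := a) hxy.1.1, ?_⟩
    show a * xy.1 ∈ b • A
    rw [hxy.2]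
    exact Finset.smul_mem_smul_finset (a := b) hxy.1.2
  · intro xy hxy xy' hxy' h
    rw [Finset.mem_coe, Finset.mem_filter] at hxy hxy'
    simp only at h
    have h1 : xy.1 = xy'.1 := mul_left_cancel₀ ha h
    have h2 : xy.2 = xy'.2 := by
      have : b * xy.2 = b * xy'.2 := by rw [← hxy.2, ← hxy'.2, h]
      exact mul_left_cancel₀ hb this
    exact Prod.ext h1 h2

/-- The representation count `r(a,b)` is at most `|A|` for `a ≠ 0`. [cite: Garaev2007, §3] -/
theorem card_filter_mul_eq_mul_le_card (A : Finset F) {a b : F} (hb : b ≠ 0) :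
    ((A ×ˢ A).filter fun xy : F × F => a * xy.1 = b * xy.2).card ≤ A.card := by
  refine Finset.card_le_card_of_injOn (fun xy => xy.1) ?_ ?_
  · intro xy hxy
    rw [Finset.mem_coe, Finset.mem_filter, Finset.mem_product] at hxy
    exact hxy.1.1
  · intro xy hxy xy' hxy' h
    rw [Finset.mem_coe, Finset.mem_filter] at hxy hxy'
    simp only at h
    have h2 : xy.2 = xy'.2 := by
      have : b * xy.2 = b * xy'.2 := by rw [← hxy.2, ← hxy'.2, h]
      exact mul_left_cancel₀ hb this
    exact Prod.ext h h2

/-- The multiplicative energy as the sum of the representation counts `r(a,b)` over `(a,b) ∈ A²`.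
[cite: Garaev2007, §3] -/
theorem mulEnergy_eq_sum_card_filter (A : Finset F) :
    Finset.mulEnergy A A =
      ∑ ab ∈ A ×ˢ A, ((A ×ˢ A).filter fun xy : F × F => ab.1 * xy.1 = ab.2 * xy.2).card := by
  classical
  unfold Finset.mulEnergy
  have hmaps : ∀ x ∈ ((A ×ˢ A) ×ˢ (A ×ˢ A)).filter
      (fun x : (F × F) × (F × F) => x.1.1 * x.2.1 = x.1.2 * x.2.2), (fun x => x.1) x ∈ A ×ˢ A := by
    intro x hx
    simp only [Finset.mem_filter, Finset.mem_product] at hx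
    show x.1 ∈ A ×ˢ A
    rw [Finset.mem_product]
    exact hx.1.1
  rw [Finset.card_eq_sum_card_fiberwise hmaps]
  refine Finset.sum_congr rfl fun ab hab => ?_
  apply Finset.card_nbij' (fun x => x.2) (fun yz => (ab, yz))
  · intro x hx
    simp only [Finset.mem_coe, Finset.mem_filter, Finset.mem_product] at hx ⊢
    obtain ⟨⟨⟨_, h2⟩, heq⟩, hab'⟩ := hx
    subst hab'
    exact ⟨h2, heq⟩
  · intro yz hyz
    simp only [Finset.mem_coe, Finset.mem_filter, Finset.mem_product] at hyz hab ⊢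
    exact ⟨⟨⟨hab, hyz.1⟩, hyz.2⟩, trivial⟩
  · intro x hx
    simp only [Finset.mem_coe, Finset.mem_filter] at hx
    show (ab, x.2) = x
    exact Prod.ext hx.2.symm rfl
  · intro yz _
    rfl

/-- Sumsets with a union of three sets: `|B + (s ∪ t ∪ u)| ≤ |B + s| + |B + t| + |B + u|`.
[folklore] -/
theorem card_add_union_three_le {G : Type*} [AddCommGroup G] [DecidableEq G] (B s t u : Finset G) :
    (B + (s ∪ t ∪ u)).card ≤ (B + s).card + (B + t).card + (B + u).card := by
  rw [Finset.add_union, Finset.add_union]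
  exact (Finset.card_union_le _ _).trans (Nat.add_le_add_right (Finset.card_union_le _ _) _)

/-- **Step 1 of Garaev's scheme** (a popular row of the energy). If `0 ∉ A ≠ ∅` and
`E×(A) ≥ |A| · S` (reals) then for some `b₀ ∈ A` the representation counts `r(a, b₀)` sum to at
least `S` over `a ∈ A`. [cite: Garaev2007, §3] -/
theorem exists_popular_row (A : Finset F) (hAne : A.Nonempty) (S : ℝ)
    (hE : (A.card : ℝ) * S ≤ (Finset.mulEnergy A A : ℝ)) :
    ∃ b₀ ∈ A, S ≤ ∑ a ∈ A, (((A ×ˢ A).filter fun xy : F × F => a * xy.1 = b₀ * xy.2).card : ℝ) := by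
  classical
  have hsum : (Finset.mulEnergy A A : ℝ) =
      ∑ b ∈ A, ∑ a ∈ A, (((A ×ˢ A).filter fun xy : F × F => a * xy.1 = b * xy.2).card : ℝ) := by
    rw [mulEnergy_eq_sum_card_filter, Nat.cast_sum, Finset.sum_product_right]
  by_contra hcon
  push Not at hcon
  have hlt : ∑ b ∈ A, ∑ a ∈ A, (((A ×ˢ A).filter fun xy : F × F => a * xy.1 = b * xy.2).card : ℝ) <
      ∑ b ∈ A, S := Finset.sum_lt_sum_of_nonempty hAne fun b hb => hcon b hb
  rw [Finset.sum_const, nsmul_eq_mul, ← hsum] at hlt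
  linarith

/-- **Sum–product in `𝔽_p`, weak explicit form** (Bourgain–Katz–Tao; Garaev's scheme). For
`A ⊆ ZMod p` with `0 ∉ A`, `|A|² < p`, `|A + A| ≤ K|A|` and `|A A| ≤ K|A|` (`K ≥ 1`):
`|A| ≤ 8 · 12⁶ · K³²`. [cite: Garaev2007, Theorem 1 (scheme of proof; weaker exponent)] -/
theorem card_le_of_small_sumset_and_productset {p : ℕ} [Fact p.Prime] (A : Finset (ZMod p))
    (K : ℝ) (hA0 : (0 : ZMod p) ∉ A) (hAne : A.Nonempty) (hK : 1 ≤ K)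
    (hp : (A.card : ℝ) ^ 2 < p) (hadd : ((A + A).card : ℝ) ≤ K * A.card)
    (hmul : ((A * A).card : ℝ) ≤ K * A.card) :
    (A.card : ℝ) ≤ 8 * 12 ^ 6 * K ^ 32 := by
  classical
  set N : ℕ := A.card with hN
  have hNpos : (0 : ℝ) < N := by exact_mod_cast hAne.card_pos
  have hK0 : (0 : ℝ) < K := by linarith
  have hne0 : ∀ a ∈ A, a ≠ 0 := fun a ha h => hA0 (h ▸ ha)
  -- the target bound dominates 2K and everything below
  have hbig : (2 : ℝ) * K ≤ 8 * 12 ^ 6 * K ^ 32 := by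
    have : K ≤ K ^ 32 := le_self_pow₀ hK (by norm_num)
    nlinarith
  -- Step 1: energy and a popular row
  set r : ZMod p → ZMod p → ℕ := fun a b =>
    ((A ×ˢ A).filter fun xy : ZMod p × ZMod p => a * xy.1 = b * xy.2).card with hr
  have hCS := Finset.le_card_mul_mul_mulEnergy A A
  have hE : (N : ℝ) * ((N : ℝ) ^ 2 / K) ≤ (Finset.mulEnergy A A : ℝ) := by
    have h1 : ((N : ℝ) ^ 2 * (N : ℝ) ^ 2) ≤ ((A * A).card : ℝ) * (Finset.mulEnergy A A : ℝ) := by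
      exact_mod_cast hCS
    have h2 : ((A * A).card : ℝ) * (Finset.mulEnergy A A : ℝ) ≤
        (K * N) * (Finset.mulEnergy A A : ℝ) :=
      mul_le_mul_of_nonneg_right hmul (Nat.cast_nonneg _)
    have h3 : (N : ℝ) ^ 2 * (N : ℝ) ^ 2 ≤ K * N * (Finset.mulEnergy A A : ℝ) := h1.trans h2
    rw [show (N : ℝ) * ((N : ℝ) ^ 2 / K) = ((N : ℝ) ^ 2 * (N : ℝ) ^ 2) / (K * N) by
      field_simp]
    rw [div_le_iff₀ (by positivity)]
    linarith
  obtain ⟨b₀, hb₀, hS⟩ := exists_popular_row A hAne ((N : ℝ) ^ 2 / K) hE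
  have hb₀0 : b₀ ≠ 0 := hne0 b₀ hb₀
  -- Step 1b: the popular set A₁
  set θ : ℝ := (N : ℝ) / (2 * K) with hθ
  have hθpos : 0 < θ := by positivity
  set A₁ := A.filter fun a => θ ≤ (r a b₀ : ℝ) with hA₁
  have hA₁A : A₁ ⊆ A := Finset.filter_subset _ _
  have hrle : ∀ a, (r a b₀ : ℝ) ≤ N := fun a => by
    exact_mod_cast card_filter_mul_eq_mul_le_card A (a := a) hb₀0
  have hA₁card : θ ≤ (A₁.card : ℝ) := by
    -- Σ_{a ∈ A} r ≤ |A₁| N + (N - |A₁|) θ and Σ ≥ N²/K = 2 N θ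
    have hsplit := Finset.sum_filter_add_sum_filter_not A (fun a => θ ≤ (r a b₀ : ℝ))
      (fun a => (r a b₀ : ℝ))
    have h1 : ∑ a ∈ A.filter (fun a => θ ≤ (r a b₀ : ℝ)), (r a b₀ : ℝ) ≤ A₁.card * N := by
      rw [← hA₁]
      calc ∑ a ∈ A₁, (r a b₀ : ℝ) ≤ ∑ a ∈ A₁, (N : ℝ) := Finset.sum_le_sum fun a _ => hrle a
        _ = A₁.card * N := by rw [Finset.sum_const, nsmul_eq_mul]
    have h2 : ∑ a ∈ A.filter (fun a => ¬ θ ≤ (r a b₀ : ℝ)), (r a b₀ : ℝ) ≤ N * θ := by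
      calc ∑ a ∈ A.filter (fun a => ¬ θ ≤ (r a b₀ : ℝ)), (r a b₀ : ℝ)
          ≤ ∑ a ∈ A.filter (fun a => ¬ θ ≤ (r a b₀ : ℝ)), θ :=
            Finset.sum_le_sum fun a ha => by
              rw [Finset.mem_filter] at ha; exact (not_le.mp ha.2).le
        _ = (A.filter (fun a => ¬ θ ≤ (r a b₀ : ℝ))).card * θ := by
            rw [Finset.sum_const, nsmul_eq_mul]
        _ ≤ N * θ := mul_le_mul_of_nonneg_right
            (by exact_mod_cast Finset.card_filter_le _ _) hθpos.le
    have h3 : (N : ℝ) ^ 2 / K = 2 * N * θ := by rw [hθ]; field_simp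
    rw [h3] at hS
    have h4 : 2 * N * θ ≤ A₁.card * N + N * θ := by rw [← hsplit] at hS; linarith
    have h5 : N * θ ≤ A₁.card * N := by linarith
    have h6 : θ ≤ A₁.card := le_of_mul_le_mul_right (by linarith) hNpos
    exact h6
  -- Step 2: |aA ± b₀A| ≤ 2K⁵ N for a ∈ A₁
  have hD : ((A - A).card : ℝ) ≤ K ^ 2 * N := by
    have h1 : ((A - A).card : ℝ) * N ≤ ((A + A).card : ℝ) ^ 2 := by
      exact_mod_cast card_sub_mul_card_le_card_add_sq hAne
    have h2 : ((A + A).card : ℝ) ^ 2 ≤ (K * N) ^ 2 :=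
      pow_le_pow_left₀ (Nat.cast_nonneg _) hadd 2
    have h3 : ((A - A).card : ℝ) * N ≤ (K ^ 2 * N) * N := by nlinarith
    exact le_of_mul_le_mul_right h3 hNpos
  have hpm : ∀ a ∈ A₁, ((a • A + b₀ • A).card : ℝ) ≤ 2 * K ^ 5 * N ∧
      ((a • A - b₀ • A).card : ℝ) ≤ 2 * K ^ 5 * N ∧
      ((b₀ • A + a • A).card : ℝ) ≤ 2 * K ^ 5 * N ∧
      ((b₀ • A - a • A).card : ℝ) ≤ 2 * K ^ 5 * N := by
    intro a ha
    rw [hA₁, Finset.mem_filter] at ha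
    have ha0 : a ≠ 0 := hne0 a ha.1
    set X := a • A ∩ b₀ • A with hX
    have hXa : X ⊆ a • A := Finset.inter_subset_left
    have hXb : X ⊆ b₀ • A := Finset.inter_subset_right
    have hXθ : θ ≤ (X.card : ℝ) := ha.2.trans (by
      exact_mod_cast card_filter_mul_eq_mul_le_card_inter A ha0 hb₀0)
    have hXpos : (0 : ℝ) < X.card := hθpos.trans_le hXθ
    have hDD : ((A - A).card : ℝ) * ((A - A).card : ℝ) ≤ (K ^ 2 * N) * (K ^ 2 * N) :=
      mul_le_mul hD hD (Nat.cast_nonneg _) (by positivity)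
    -- generic conclusion from `T · |X| ≤ |A−A|²`
    have conclude : ∀ T : ℕ, T * X.card ≤ (A - A).card * (A - A).card →
        (T : ℝ) ≤ 2 * K ^ 5 * N := by
      intro T hT
      have h1 : (T : ℝ) * X.card ≤ (K ^ 2 * N) * (K ^ 2 * N) := by
        have : (T : ℝ) * X.card ≤ ((A - A).card : ℝ) * ((A - A).card : ℝ) := by exact_mod_cast hT
        exact this.trans hDD
      have h2 : (T : ℝ) * θ ≤ (T : ℝ) * X.card := mul_le_mul_of_nonneg_left hXθ (Nat.cast_nonneg _)
      have h3 : (T : ℝ) * θ ≤ (K ^ 2 * N) * (K ^ 2 * N) := h2.trans h1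
      rw [hθ] at h3
      have h4 : (T : ℝ) * N ≤ 2 * K * ((K ^ 2 * N) * (K ^ 2 * N)) := by
        have := mul_le_mul_of_nonneg_left h3 (show (0 : ℝ) ≤ 2 * K by positivity)
        have e : 2 * K * ((T : ℝ) * (N / (2 * K))) = (T : ℝ) * N := by field_simp
        linarith
      have h5 : (T : ℝ) * N ≤ (2 * K ^ 5 * N) * N := by nlinarith
      exact le_of_mul_le_mul_right h5 hNpos
    refine ⟨conclude _ (card_smul_add_smul_mul_le A X ha0 hb₀0 hXa hXb),
      conclude _ (card_smul_sub_smul_mul_le A X ha0 hb₀0 hXa hXb),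
      conclude _ (card_smul_add_smul_mul_le A X hb₀0 ha0 hXb hXa),
      conclude _ (card_smul_sub_smul_mul_le A X hb₀0 ha0 hXb hXa)⟩
  -- Step 3: the dichotomy on A₁ (or A₁ is tiny)
  by_cases hsmall : A₁.card ≤ 1
  · have : θ ≤ 1 := hA₁card.trans (by exact_mod_cast hsmall)
    rw [hθ, div_le_one (by positivity)] at this
    linarith
  have h2A₁ : 2 ≤ A₁.card := by omega
  have hpA₁ : A₁.card ^ 2 < p := by
    have h1 : A₁.card ^ 2 ≤ N ^ 2 := Nat.pow_le_pow_left (Finset.card_le_card hA₁A) 2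
    have h2 : ((N ^ 2 : ℕ) : ℝ) < p := by push_cast; exact hp
    have h3 : N ^ 2 < p := by exact_mod_cast h2
    omega
  obtain ⟨a₁, ha₁, a₂, ha₂, a₃, ha₃, a₄, ha₄, a₅, ha₅, a₆, ha₆, hGK⟩ :=
    glibichuk_konyagin_six_dilates A₁ h2A₁ hpA₁
  have hmono : (a₁ • A₁ - a₂ • A₁ + a₃ • A₁ - a₄ • A₁ + a₅ • A₁ - a₆ • A₁) ⊆
      (a₁ • A - a₂ • A + a₃ • A - a₄ • A + a₅ • A - a₆ • A) := by
    have s : ∀ c : ZMod p, c • A₁ ⊆ c • A := fun c => Finset.smul_finset_subset_smul_finset hA₁A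
    exact Finset.sub_subset_sub (Finset.add_subset_add (Finset.sub_subset_sub (Finset.add_subset_add
      (Finset.sub_subset_sub (s a₁) (s a₂)) (s a₃)) (s a₄)) (s a₅)) (s a₆)
  -- Step 4: the six-fold sum inside 6Y and Plünnecke–Ruzsa with base b₀A
  set Y := (a₁ • A ∪ a₃ • A ∪ a₅ • A) ∪ ((-a₂) • A ∪ (-a₄) • A ∪ (-a₆) • A) with hY
  have hY1 : a₁ • A ⊆ Y := by
    rw [hY]; exact (Finset.subset_union_left.trans Finset.subset_union_left).trans Finset.subset_union_left
  have hY3 : a₃ • A ⊆ Y := by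
    rw [hY]; exact (Finset.subset_union_right.trans Finset.subset_union_left).trans Finset.subset_union_left
  have hY5 : a₅ • A ⊆ Y := by
    rw [hY]; exact Finset.subset_union_right.trans Finset.subset_union_left
  have hY2 : -(a₂ • A) ⊆ Y := by
    rw [hY, ← Finset.neg_smul_finset]
    exact (Finset.subset_union_left.trans Finset.subset_union_left).trans Finset.subset_union_right
  have hY4 : -(a₄ • A) ⊆ Y := by
    rw [hY, ← Finset.neg_smul_finset]
    exact (Finset.subset_union_right.trans Finset.subset_union_left).trans Finset.subset_union_right
  have hY6 : -(a₆ • A) ⊆ Y := by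
    rw [hY, ← Finset.neg_smul_finset]
    exact Finset.subset_union_right.trans Finset.subset_union_right
  have hsix : (a₁ • A - a₂ • A + a₃ • A - a₄ • A + a₅ • A - a₆ • A) ⊆ Y + Y + Y + Y + Y + Y := by
    rw [sub_eq_add_neg (a₁ • A), sub_eq_add_neg _ (a₄ • A), sub_eq_add_neg _ (a₆ • A)]
    exact Finset.add_subset_add (Finset.add_subset_add (Finset.add_subset_add (Finset.add_subset_add
      (Finset.add_subset_add hY1 hY2) hY3) hY4) hY5) hY6
  have hB₀ne : (b₀ • A).Nonempty := hAne.smul_finset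
  have hB₀card : (b₀ • A).card = N := Finset.card_smul_finset₀ hb₀0 A
  have hPR := card_nsmul_mul_pow_le hB₀ne Y 6
  have h6Y : (6 : ℕ) • Y = Y + Y + Y + Y + Y + Y := by
    rw [show (6 : ℕ) = 0 + 1 + 1 + 1 + 1 + 1 + 1 from rfl]
    simp only [succ_nsmul, zero_nsmul, zero_add]
  rw [h6Y, hB₀card] at hPR
  -- |b₀A + Y| ≤ 12 K⁵ N
  have hBY : ((b₀ • A + Y).card : ℝ) ≤ 12 * K ^ 5 * N := by
    have hplus : ∀ a ∈ A₁, ((b₀ • A + a • A).card : ℝ) ≤ 2 * K ^ 5 * N := fun a ha => (hpm a ha).2.2.1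
    have hminus : ∀ a ∈ A₁, ((b₀ • A + (-a) • A).card : ℝ) ≤ 2 * K ^ 5 * N := by
      intro a ha
      rw [Finset.neg_smul_finset, ← sub_eq_add_neg]
      exact (hpm a ha).2.2.2
    have hnat : (b₀ • A + Y).card ≤
        ((b₀ • A + a₁ • A).card + (b₀ • A + a₃ • A).card + (b₀ • A + a₅ • A).card) +
        ((b₀ • A + (-a₂) • A).card + (b₀ • A + (-a₄) • A).card + (b₀ • A + (-a₆) • A).card) := by
      rw [hY, Finset.add_union]
      exact (Finset.card_union_le _ _).trans
        (Nat.add_le_add (card_add_union_three_le _ _ _ _) (card_add_union_three_le _ _ _ _))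
    have hR : ((b₀ • A + Y).card : ℝ) ≤
        (((b₀ • A + a₁ • A).card : ℝ) + ((b₀ • A + a₃ • A).card : ℝ) + ((b₀ • A + a₅ • A).card : ℝ)) +
        (((b₀ • A + (-a₂) • A).card : ℝ) + ((b₀ • A + (-a₄) • A).card : ℝ) +
          ((b₀ • A + (-a₆) • A).card : ℝ)) := by
      exact_mod_cast hnat
    have e : (12 : ℝ) * K ^ 5 * N = (2 * K ^ 5 * N + 2 * K ^ 5 * N + 2 * K ^ 5 * N) +
        (2 * K ^ 5 * N + 2 * K ^ 5 * N + 2 * K ^ 5 * N) := by ring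
    rw [e]
    exact hR.trans (add_le_add (add_le_add (add_le_add (hplus a₁ ha₁) (hplus a₃ ha₃)) (hplus a₅ ha₅))
      (add_le_add (add_le_add (hminus a₂ ha₂) (hminus a₄ ha₄)) (hminus a₆ ha₆)))
  -- |Y+Y+Y+Y+Y+Y| ≤ (12K⁵)⁶ N
  have h6card : ((Y + Y + Y + Y + Y + Y).card : ℝ) ≤ (12 * K ^ 5) ^ 6 * N := by
    have h1 : ((Y + Y + Y + Y + Y + Y).card : ℝ) * (N : ℝ) ^ 6 ≤
        ((b₀ • A + Y).card : ℝ) ^ 6 * N := by exact_mod_cast hPR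
    have h2 : ((b₀ • A + Y).card : ℝ) ^ 6 * N ≤ (12 * K ^ 5 * N) ^ 6 * N :=
      mul_le_mul_of_nonneg_right (pow_le_pow_left₀ (Nat.cast_nonneg _) hBY 6) (Nat.cast_nonneg _)
    have h3 : ((Y + Y + Y + Y + Y + Y).card : ℝ) * (N : ℝ) ^ 6 ≤
        ((12 * K ^ 5) ^ 6 * N) * (N : ℝ) ^ 6 := by
      calc _ ≤ (12 * K ^ 5 * N) ^ 6 * N := h1.trans h2
        _ = ((12 * K ^ 5) ^ 6 * N) * (N : ℝ) ^ 6 := by ring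
    exact le_of_mul_le_mul_right h3 (by positivity)
  -- Step 5: assemble  (N/2K)² ≤ |A₁|² ≤ 2 (12K⁵)⁶ N
  have hA₁sq : ((A₁.card : ℝ)) ^ 2 ≤ 2 * ((12 * K ^ 5) ^ 6 * N) := by
    have h1 : ((A₁.card ^ 2 : ℕ) : ℝ) ≤
        ((2 * (a₁ • A₁ - a₂ • A₁ + a₃ • A₁ - a₄ • A₁ + a₅ • A₁ - a₆ • A₁).card : ℕ) : ℝ) := by
      exact_mod_cast hGK
    push_cast at h1
    have h2 : ((a₁ • A₁ - a₂ • A₁ + a₃ • A₁ - a₄ • A₁ + a₅ • A₁ - a₆ • A₁).card : ℝ) ≤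
        ((Y + Y + Y + Y + Y + Y).card : ℝ) := by
      exact_mod_cast Finset.card_le_card (hmono.trans hsix)
    linarith
  have hθ2 : θ ^ 2 ≤ 2 * ((12 * K ^ 5) ^ 6 * N) :=
    (pow_le_pow_left₀ hθpos.le hA₁card 2).trans hA₁sq
  rw [hθ] at hθ2
  -- (N/(2K))² ≤ 2·12⁶ K³⁰ N  ⇒  N ≤ 8·12⁶ K³²
  have hfin : (N : ℝ) * N ≤ (8 * 12 ^ 6 * K ^ 32) * N := by
    have e1 : ((N : ℝ) / (2 * K)) ^ 2 * (4 * K ^ 2) = (N : ℝ) * N := by field_simp; ring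
    have e2 : 2 * ((12 * K ^ 5) ^ 6 * (N : ℝ)) * (4 * K ^ 2) = (8 * 12 ^ 6 * K ^ 32) * N := by ring
    have := mul_le_mul_of_nonneg_right hθ2 (show (0 : ℝ) ≤ 4 * K ^ 2 by positivity)
    rw [e1, e2] at this
    exact this
  exact le_of_mul_le_mul_right hfin hNpos

/-- **Sum–product in `𝔽_p`, packaged with absolute constants** (the shape used downstream):
there are `C₀, e₀ > 0` such that `0 ∉ A ≠ ∅`, `|A|² < p`, `|A + A| ≤ K|A|`, `|AA| ≤ K|A|`,
`K ≥ 1` imply `|A| ≤ C₀ K^{e₀}` (here `C₀ = 8·12⁶`, `e₀ = 32`).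
[cite: Garaev2007, Theorem 1 (scheme of proof; weaker exponent)] -/
theorem exists_sum_product_constants :
    ∃ C₀ : ℝ, 0 < C₀ ∧ ∃ e₀ : ℝ, 0 < e₀ ∧ ∀ (p : ℕ) [Fact (Nat.Prime p)] (A : Finset (ZMod p)) (K : ℝ),
      (0 : ZMod p) ∉ A → A.Nonempty → 1 ≤ K → (A.card : ℝ) ^ 2 < (p : ℝ) →
      ((A + A).card : ℝ) ≤ K * A.card → ((A * A).card : ℝ) ≤ K * A.card →
      (A.card : ℝ) ≤ C₀ * K ^ e₀ := by
  refine ⟨8 * 12 ^ 6, by norm_num, 32, by norm_num, ?_⟩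
  intro p _ A K hA0 hAne hK hp hadd hmul
  have h := card_le_of_small_sumset_and_productset A K hA0 hAne hK hp hadd hmul
  have e : K ^ (32 : ℝ) = K ^ (32 : ℕ) := by
    rw [← Real.rpow_natCast]; norm_num
  rw [e]
  linarith

end SumProduct

end Literature.Combinatorics.Additive
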